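import Summits.QuantumFields.BalabanUV.Beta.FP.NestedDoorSocketTower
import Summits.QuantumFields.BalabanUV.Beta.FP.NestedStepLawTorusCompositeOneShotTopGB

/-!
# BOUNDED-LEVELS TWIN `NestedDoorSocketTowerGB` (R-FP-76, the repair of E-FP-34-1, journal l.64955): the statements and proofs of `NestedDoorSocketTowerG` VERBATIM but for the displayed
# clause `hlev : ∀ i, i ≤ n → lev i = lev (i + 1) + 1` (the original `∀ i, lev i = lev (i + 1) + 1` is unsatisfiable for `lev : ℕ → ℕ`, so the original theorem is
# vacuous — kernel-proved, `HOME/b2b-balaban-beta-d1-p3/g34/hlev/HlevVacuous.lean`) and the `B` suppliers; helper lemmas without `hlev` are imported from the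
# original, not re-declared.  Generator `HOME/b2b-balaban-beta-d1-p3/g34/recut/recutB.py` over the TREE bytes.  Road «FP» OWNER d1-p3 gen 34, 2026-08-25.  ORIGINAL HEADER:
# `BalabanUV.Beta.FP.NestedDoorSocketTowerG` — road «FP» for binder row D1, ROUTE T under RULING R-D1-g52-1 (β1) ∕ R-FP-70: **THE `-G` EDITION OF #41c
# `NestedDoorSocketTower` — #21-G BY TERM PER DIRECTION THROUGH THE SOCKET #41a, GENERIC OVER `(Q : StepRows d Lc, K)`** (the first of the road's four
# «generator passes»: SPEC #41 STEPS 1+2 at the tower's door for ANY one-step brick)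

WHAT.  #41c's binder block and proof VERBATIM but for: the direction-free pins over `K (lev (n+1)) (rs (n+1))` and `compRowsG Lc Q`; the top step's rows `Q₂₀`
ABSTRACT (its slot index type `κ` kept — the top averaging jets `Q₂₁f Q₂₂f`, the coarse generator `Xbf`, the namings `𝔔` live on it); the nine direction-free
brick inputs of #21-G DISPLAYED (`hH₀t hone hId htop a0 hSL c0 hTW d0` — v1.1, R-FP-71 «display what you use»: `hSL c0 hTW` replace v1's
universal covariance family `hc0`, unsatisfiable at the (0.4)-sym kernel off the centred root list, leaf-02 g31 W-1 l.56632) and passed to `NestedStepLawTorusCompositeOneShotTopG.…_of_uTop_G` in the per-direction call;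
the socket `NestedDoorSocket.mixedVar_kernel_law_of_nested_door` and #33's directional law BY NAME as in #41c.  Rooted instance = #41c (at `Q := Qstep Lc`,
`K ℓ r := bhKStepAt d (toSite r) Lc ℓ`, the nine inputs by `H₀_transpose_of_dvd ∕ torus_h1 ∕ hId_order_zero_record ∕ torus_isUnit_det_kkt_combRows ∕ torus_a0_tower ∕
det_nestedSlice_mul_towerGen_ne_zero ∕ compRows_mul_towerGen_succ ∕ torus_hTW_oneShot_tower ∕ Qtop_mul_smul_tgrad_res`); sym instance over #21-Sym's letters (successor: `NestedDoorSocketTowerSym`, or directly #41d-G's).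
[folklore] composition BY NAME; no `def`, no `def … : Prop`, nothing cited, 0 sorry.  Rows, legs and namings are HYPOTHESES; nothing of the dictionary ∕
Bałaban's asserted (the presentation is the row's (β1) ruling, quoted).  No existing file touched.

HONEST DEPENDENCY (page 1, mandatory): continuum YM on T⁴ ⇐ BetaPertH ∧ nine spine estimates (0/9 proved); BetaPertH ⇐ (D1) ∧ (D4) ∧ CAP+tail;
G-an2-4 gates asym, D1 and NE2/3/4.  HONEST FRAMING (cell contract, verbatim): «discharging `BetaPertH` makes Bałaban's UV stability UNCONDITIONAL —
a real constructive-QFT result; it is NOT the continuum limit and NOT the Clay problem.»  ABSOLUTE RULE (cell charter, verbatim): «No internally-minted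
statement may enter as a cited fact. Every hypothesis is either kernel-proved in this package or a verbatim quotation of a PUBLISHED theorem with page
reference. The manuscript(s) under audit are NOT citable for their own disputed steps — they are the thing under adjudication; programme-internal
(2001/route/tribunal) claims are never citable.»  0 estimates; 0∕4 row-D1 binders (hW, hR, D1Tel, D1Rep); ROOT M‴ p325680 untouched; NOT (C1), NOT (L2′),
NOT (T-ID), NOT SDF, NOT D1, NOT BetaPertH, NOT continuum, NOT Clay.  Road «FP» OWNER, b2b-balaban-beta-d1-p3 gen 29∕30 (v1) ∕ gen 31 (v1.1, R-FP-71), 2026-08-24.  No existing file touched.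
-/

noncomputable section

namespace Summit.QuantumFields.BalabanUV.Beta.FP.NestedDoorSocketTowerGB

open scoped BigOperators Matrix
open Matrix Finset
open Literature.Probability.LatticeModels (Torus.proj)
open Literature.MathematicalPhysics.QuantumFieldTheory.Balaban1983to89
open Literature.MathematicalPhysics.QuantumFieldTheory.Balaban1983to89.Beta
open Literature.MathematicalPhysics.QuantumFieldTheory.Balaban1983to89.Beta.Composition (kkt)
open Literature.MathematicalPhysics.QuantumFieldTheory.Balaban1983to89.Beta.CompositionSingular (effForm flucCov minOp minOpL)
open B5Prop11Plancherel (fine)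
open B6Lemma24Torus (pbox mem_pbox)
open AffineAveraging (Site box toSite unitVec)
open OneStepResolventKernel (Fib)
open Summit.QuantumFields.BalabanUV.Beta.BorderedHessian (bhKStepAt stepScale)
open Summit.QuantumFields.BalabanUV.Beta.D1BFx.LogDetSecondVariation (secondVar)
open Summit.QuantumFields.BalabanUV.Beta.FP.SecondVarPolarisation (mixedVar)
open Summit.QuantumFields.BalabanUV.Beta.D1BFx.MixedVarPackedHess (hessT)
open Summit.QuantumFields.BalabanUV.Beta.FP.KernelPeriodisationFib (Idx perF)
open Summit.QuantumFields.BalabanUV.Beta.FP.TorusCombRows (Res)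
open Summit.QuantumFields.BalabanUV.Beta.FP.TorusCompositeObjects (towerTorus compRows NParam combF bigP towerGen)
open Summit.QuantumFields.BalabanUV.Beta.FP.TorusCompositeFP (evalN)
open Summit.QuantumFields.BalabanUV.Beta.FP.TorusGaugeCovariance (tgrad)
open Summit.QuantumFields.BalabanUV.Beta.GAN24.FineReadoutCauchyFrame (toSite_mem_range)
open Summit.QuantumFields.BalabanUV.Beta.FP.DirectionalJetShapes (lin_negDiagonal_comp)
open Summit.QuantumFields.BalabanUV.Beta.FP.LevelZeroDoorShapes (hessT_law_of_mixedVar_law)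
open Summit.QuantumFields.BalabanUV.Beta.FP.NestedDoorSocket (mixedVar_kernel_law_of_nested_door)
open Summit.QuantumFields.BalabanUV.Beta.FP.NestedStepLawTorusCompositeOneShotTop (secondVar_oneShot_nestedStepLaw_torus_composite_graded_oneShot_of_uTop)
open Summit.QuantumFields.BalabanUV.Beta.FP.TorusCompositeObjectsG (StepRows compRowsG nestedSliceG)
open Summit.QuantumFields.BalabanUV.Beta.FP.NestedStepLawTorusCompositeOneShotTopGB (secondVar_oneShot_nestedStepLaw_torus_composite_graded_oneShot_of_uTop_G)
open ExpKernelCalculus (MKer)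
open BalabanStepJetsSucc (wVH)

variable {d : ℕ}

section TowerG

variable (M' : Fin (d + 1) → ℕ) [∀ μ, NeZero (M' μ)] (Lc : ℕ) [NeZero Lc] (lev : ℕ → ℕ) (rs : ℕ → (Fin (d + 1) → ℕ)) (n : ℕ)

/-- [folklore] **`-G` OF #41c `hessT_kernel_law_tower`** — #21-G by term per direction through #41a's socket; direction-free brick inputs displayed
(v1.1, R-FP-71: `hSL c0 hTW` displayed as used, no universal covariance family). -/
theorem hessT_kernel_law_tower_G (Q : StepRows d Lc) (K : ℕ → (Fin (d + 1) → ℕ) → MKer (d + 1) (Fib d)) (hrs : ∀ k, rs k ∈ box (d + 1) Lc) (hlev : ∀ i, i ≤ n → lev i = lev (i + 1) + 1)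
    (hM' : ∀ i, Lc ∣ M' i)
    -- the top multipliers' slot presentation (#21 VERBATIM)
    {κ : Type*} [Fintype κ] [DecidableEq κ]
    -- the composite objects PINNED over the abstract families: finest form `K (lev (n+1)) (rs (n+1))`, rows `compRowsG Lc Q`, nested slice `nestedSliceG Lc Q`
    {H₀ : Matrix (↥(pbox (towerTorus Lc M' (n + 1))) × Fin (d + 1)) (↥(pbox (towerTorus Lc M' (n + 1))) × Fin (d + 1)) ℝ}
    {Q₁₀ : Matrix (↥(pbox M') × Fin (d + 1)) (↥(pbox (towerTorus Lc M' (n + 1))) × Fin (d + 1)) ℝ}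
    {τ₁ : Matrix (NParam Lc (fine Lc M') (fun k => rs (k + 1)) n) (↥(pbox (towerTorus Lc M' (n + 1))) × Fin (d + 1)) ℝ}
    (hH₀ : H₀ = (perF (towerTorus Lc M' (n + 1)) (K (lev (n + 1)) (rs (n + 1)))).submatrix
        (fun b : (↥(pbox (towerTorus Lc M' (n + 1))) × Fin (d + 1)) => ((b.1, Sum.inl b.2) : Idx (towerTorus Lc M' (n + 1)) (Fib d)))
        (fun b : (↥(pbox (towerTorus Lc M' (n + 1))) × Fin (d + 1)) => ((b.1, Sum.inl b.2) : Idx (towerTorus Lc M' (n + 1)) (Fib d))))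
    (hQ₁₀ : Q₁₀ = compRowsG Lc Q M' lev rs (n + 1))
    (hτ₁ : τ₁ = bigP Lc (fine Lc M') (fun k => rs (k + 1)) (fun k => toSite_mem_range (hrs (k + 1))) n)
    -- DISPLAYED BRICK INPUTS (discharged per instance): the finest form block is symmetric; leaf-05's one-step letters (h1)ₖ ∕ (hId)ₖ at every storey
    (hH₀t : H₀ᵀ = H₀)
    (hone : ∀ (k : ℕ) (T : Fin (d + 1) → ℕ) [∀ μ, NeZero (T μ)],
      (kkt ((perF (fine Lc T) (K (lev k) (rs k))).submatrix
            (fun b : ↥(pbox (fine Lc T)) × Fin (d + 1) => ((b.1, Sum.inl b.2) : Idx (fine Lc T) (Fib d)))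
            (fun b : ↥(pbox (fine Lc T)) × Fin (d + 1) => ((b.1, Sum.inl b.2) : Idx (fine Lc T) (Fib d))))
        (fromRows (Q T (lev k) (rs k)) (combF Lc (fine Lc T) (rs k)))).det ≠ 0)
    (hId : ∀ (k : ℕ) (T : Fin (d + 1) → ℕ) [∀ μ, NeZero (T μ)] (r' : Fin (d + 1) → ℕ),
      (effForm ((perF (fine Lc T) (K (lev k) (rs k))).submatrix
            (fun b : ↥(pbox (fine Lc T)) × Fin (d + 1) => ((b.1, Sum.inl b.2) : Idx (fine Lc T) (Fib d)))
            (fun b : ↥(pbox (fine Lc T)) × Fin (d + 1) => ((b.1, Sum.inl b.2) : Idx (fine Lc T) (Fib d))))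
          (fromRows (Q T (lev k) (rs k)) (combF Lc (fine Lc T) (rs k)))).toBlocks₁₁
        = (wVH d Lc (lev k + 1))⁻¹ • (perF T (K (lev k + 1) r')).submatrix
            (fun b : ↥(pbox T) × Fin (d + 1) => ((b.1, Sum.inl b.2) : Idx T (Fib d)))
            (fun b : ↥(pbox T) × Fin (d + 1) => ((b.1, Sum.inl b.2) : Idx T (Fib d))))
    -- (SLICE-m) OF THE TOWER BELOW `M′`, DISPLAYED (R-FP-71 «display what you use»): its NESTED comb slice is transversal to its generators
    -- (rooted: leaf-06 `TorusCompositeSlice.det_nestedSlice_mul_towerGen_ne_zero`; sym: leaf-06's G-1 sym theorem at the constant root list, fed leaf-02's R-20)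
    (hSL : (nestedSliceG Lc Q (fine Lc M') (fun k => lev (k + 1)) (fun k => rs (k + 1)) n
        * towerGen Lc (fine Lc M') (fun k => rs (k + 1)) n).det ≠ 0)
    {τ₂ : Matrix (Res (toSite (rs 0)) Lc M') (↥(pbox M') × Fin (d + 1)) ℝ} (hτ₂ : τ₂ = combF Lc M' (rs 0))
    (Q₂₀ : Matrix κ (↥(pbox M') × Fin (d + 1)) ℝ)
    (htop : (kkt ((perF M' (K (lev 0) (rs 0))).submatrix (fun b : ↥(pbox M') × Fin (d + 1) => ((b.1, Sum.inl b.2) : Idx M' (Fib d)))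
        (fun b : ↥(pbox M') × Fin (d + 1) => ((b.1, Sum.inl b.2) : Idx M' (Fib d)))) (fromRows Q₂₀ τ₂)).det ≠ 0)
    {W₀ : Matrix (↥(pbox (towerTorus Lc M' (n + 1))) × Fin (d + 1)) (NParam Lc M' rs (n + 1)) ℝ} (hW₀ : W₀ = towerGen Lc M' rs (n + 1))
    {P : Matrix (NParam Lc M' rs (n + 1)) (↥(pbox (towerTorus Lc M' (n + 1))) × Fin (d + 1)) ℝ} (hP : P = bigP Lc M' rs (fun k => toSite_mem_range (hrs k)) (n + 1))
    -- the step constant of the chart transport (#21's `c`), the (COV-m) order-0 image PINNED, the one-shot resolvent words and `𝔔₀` NAMED (#21 VERBATIM)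
    (c : ℝ)
    {Dbar : Matrix (↥(pbox M') × Fin (d + 1)) (Res (toSite (rs 0)) Lc M') ℝ}
    (hDbar : Dbar = (∏ i ∈ range (n + 1), (stepScale d Lc (lev (i + 1)) * ((box (d + 1) Lc).card : ℝ))) •
        (tgrad M').submatrix (fun a : (↥(pbox M') × Fin (d + 1)) => ((a.1, Sum.inl a.2) : Idx M' (Fib d))) (fun t : (Res (toSite (rs 0)) Lc M') => (t.1 : ↥(pbox M'))))
    -- (COV-m) ORDER 0 AT THE TOP DEPTH in the pinned letters and the ONE-SHOT slice's transversality, DISPLAYED (R-FP-71 «display what you use»;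
    -- rooted: leaf-02 `compRows_mul_towerGen_succ` ∕ leaf-06 `torus_hTW_oneShot_tower`; sym: leaf-02's R-20 at the constant root list ∕ leaf-06 G-2 §2)
    (c0 : Q₁₀ * W₀ = fromCols Dbar (0 : Matrix (↥(pbox M') × Fin (d + 1)) (NParam Lc (fine Lc M') (fun k => rs (k + 1)) n) ℝ))
    (hTW : (Matrix.fromRows (τ₂ * Q₁₀) τ₁ * W₀).det ≠ 0)
    {Γ : Matrix (↥(pbox (towerTorus Lc M' (n + 1))) × Fin (d + 1)) (↥(pbox (towerTorus Lc M' (n + 1))) × Fin (d + 1)) ℝ} {I : Matrix (↥(pbox (towerTorus Lc M' (n + 1))) × Fin (d + 1)) ((↥(pbox M') × Fin (d + 1)) ⊕ (NParam Lc (fine Lc M') (fun k => rs (k + 1)) n)) ℝ} {L : Matrix ((↥(pbox M') × Fin (d + 1)) ⊕ (NParam Lc (fine Lc M') (fun k => rs (k + 1)) n)) (↥(pbox (towerTorus Lc M' (n + 1))) × Fin (d + 1)) ℝ} {S : Matrix ((↥(pbox M') × Fin (d + 1)) ⊕ (NParam Lc (fine Lc M') (fun k => rs (k + 1)) n)) ((↥(pbox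 M') × Fin (d + 1)) ⊕ (NParam Lc (fine Lc M') (fun k => rs (k + 1)) n)) ℝ}
    (hΓ : flucCov H₀ (fromRows Q₁₀ τ₁) = Γ) (hI : minOp H₀ (fromRows Q₁₀ τ₁) = I) (hL : minOpL H₀ (fromRows Q₁₀ τ₁) = L) (hS : effForm H₀ (fromRows Q₁₀ τ₁) = S)
    {𝔔₀ : Matrix κ (↥(pbox (towerTorus Lc M' (n + 1))) × Fin (d + 1)) ℝ} (h𝔔₀ : Q₂₀ * Q₁₀ = 𝔔₀)
    -- the direction module and its DISPLAYED read-outs: finest-level direction `h := hv v` (enters only the rows and the generator jets — no linearity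
    -- needed here: the jets' (bi)linearity is displayed; at the record it follows from `hv`'s), tree-gauge parameter `λ := lv v` and top generator
    -- `X̄ := Xbf v` (LINEAR: they enter the one-shot namings `k1 k2 q1 q2`)
    {V : Type*} [AddCommGroup V] [Module ℝ V]
    (hv : V → ((↥(pbox (towerTorus Lc M' (n + 1))) × Fin (d + 1)) → ℝ)) (lv : V → (↥(pbox (towerTorus Lc M' (n + 1))) → ℝ))
    (hlv : ∀ (r : ℝ) (x y : V), lv (r • x + y) = r • lv x + lv y)
    (Xbf : V → Matrix κ κ ℝ) (hXbf : ∀ (r : ℝ) (x y : V), Xbf (r • x + y) = r • Xbf x + Xbf y)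
    -- #21's displayed jets AS FUNCTIONS of the direction: first order linear, second order in two slots (linear in each; the door reads the diagonal)
    (H₁f : V → Matrix (↥(pbox (towerTorus Lc M' (n + 1))) × Fin (d + 1)) (↥(pbox (towerTorus Lc M' (n + 1))) × Fin (d + 1)) ℝ) (hH₁l : ∀ (r : ℝ) (x y : V), H₁f (r • x + y) = r • H₁f x + H₁f y)
    (Q₁₁f : V → Matrix (↥(pbox M') × Fin (d + 1)) (↥(pbox (towerTorus Lc M' (n + 1))) × Fin (d + 1)) ℝ) (hQ₁₁l : ∀ (r : ℝ) (x y : V), Q₁₁f (r • x + y) = r • Q₁₁f x + Q₁₁f y)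
    (Q₂₁f : V → Matrix κ (↥(pbox M') × Fin (d + 1)) ℝ) (hQ₂₁l : ∀ (r : ℝ) (x y : V), Q₂₁f (r • x + y) = r • Q₂₁f x + Q₂₁f y)
    (H₂f : V → V → Matrix (↥(pbox (towerTorus Lc M' (n + 1))) × Fin (d + 1)) (↥(pbox (towerTorus Lc M' (n + 1))) × Fin (d + 1)) ℝ)
    (hH₂l : ∀ (r : ℝ) (x y z : V), H₂f (r • x + y) z = r • H₂f x z + H₂f y z) (hH₂r : ∀ (r : ℝ) (x y z : V), H₂f z (r • x + y) = r • H₂f z x + H₂f z y)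
    (Q₁₂f : V → V → Matrix (↥(pbox M') × Fin (d + 1)) (↥(pbox (towerTorus Lc M' (n + 1))) × Fin (d + 1)) ℝ)
    (hQ₁₂l : ∀ (r : ℝ) (x y z : V), Q₁₂f (r • x + y) z = r • Q₁₂f x z + Q₁₂f y z) (hQ₁₂r : ∀ (r : ℝ) (x y z : V), Q₁₂f z (r • x + y) = r • Q₁₂f z x + Q₁₂f z y)
    (Q₂₂f : V → V → Matrix κ (↥(pbox M') × Fin (d + 1)) ℝ)
    (hQ₂₂l : ∀ (r : ℝ) (x y z : V), Q₂₂f (r • x + y) z = r • Q₂₂f x z + Q₂₂f y z) (hQ₂₂r : ∀ (r : ℝ) (x y z : V), Q₂₂f z (r • x + y) = r • Q₂₂f z x + Q₂₂f z y)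
    -- #21's composite and one-shot NAMINGS as functions (`h𝔔₁ h𝔔₂ k1 k2 q1 q2`; `X := −(c • diagonal (λ ∘ pr))` at `λ := lv v`; order 2 in two slots)
    (𝔔₁f : V → Matrix κ (↥(pbox (towerTorus Lc M' (n + 1))) × Fin (d + 1)) ℝ) (h𝔔₁ : ∀ v, Q₂₁f v * Q₁₀ + Q₂₀ * Q₁₁f v = 𝔔₁f v)
    (𝔔₂f : V → V → Matrix κ (↥(pbox (towerTorus Lc M' (n + 1))) × Fin (d + 1)) ℝ)
    (h𝔔₂ : ∀ v v', Q₂₂f v v' * Q₁₀ + Q₂₁f v * Q₁₁f v' + (Q₂₁f v * Q₁₁f v' + Q₂₀ * Q₁₂f v v') = 𝔔₂f v v')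
    (H'₁f : V → Matrix (↥(pbox (towerTorus Lc M' (n + 1))) × Fin (d + 1)) (↥(pbox (towerTorus Lc M' (n + 1))) × Fin (d + 1)) ℝ)
    (hH'₁f : ∀ v, H'₁f v = -((-(c • Matrix.diagonal (fun b : (↥(pbox (towerTorus Lc M' (n + 1))) × Fin (d + 1)) => lv v b.1)))ᵀ * H₀) + H₁f v + H₀ * (-(c • Matrix.diagonal (fun b : (↥(pbox (towerTorus Lc M' (n + 1))) × Fin (d + 1)) => lv v b.1))))
    (H'₂f : V → V → Matrix (↥(pbox (towerTorus Lc M' (n + 1))) × Fin (d + 1)) (↥(pbox (towerTorus Lc M' (n + 1))) × Fin (d + 1)) ℝ)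
    (hH'₂f : ∀ v v', H'₂f v v' = ((-(c • Matrix.diagonal (fun b : (↥(pbox (towerTorus Lc M' (n + 1))) × Fin (d + 1)) => lv v b.1))) * (-(c • Matrix.diagonal (fun b : (↥(pbox (towerTorus Lc M' (n + 1))) × Fin (d + 1)) => lv v' b.1))))ᵀ * H₀ + (-((-(c • Matrix.diagonal (fun b : (↥(pbox (towerTorus Lc M' (n + 1))) × Fin (d + 1)) => lv v b.1)))ᵀ * H₁f v') + -((-(c • Matrix.diagonal (fun b : (↥(pbox (towerTorus Lc M' (n + 1))) × Fin (d + 1)) => lv v b.1)))ᵀ * H₀ * (-(c • Matrix.diagonal (fun b : (↥(pbox (towerTorus Lc M' (n + 1))) × Fin (d + 1)) => lv v' b.1)))))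
      + ((-((-(c • Matrix.diagonal (fun b : (↥(pbox (towerTorus Lc M' (n + 1))) × Fin (d + 1)) => lv v b.1)))ᵀ * H₁f v') + -((-(c • Matrix.diagonal (fun b : (↥(pbox (towerTorus Lc M' (n + 1))) × Fin (d + 1)) => lv v b.1)))ᵀ * H₀ * (-(c • Matrix.diagonal (fun b : (↥(pbox (towerTorus Lc M' (n + 1))) × Fin (d + 1)) => lv v' b.1))))) + (H₂f v v' + H₁f v * (-(c • Matrix.diagonal (fun b : (↥(pbox (towerTorus Lc M' (n + 1))) × Fin (d + 1)) => lv v' b.1))) + (H₁f v * (-(c • Matrix.diagonal (fun b : (↥(pbox (towerTorus Lc M' (n + 1))) × Fin (d + 1)) => lv v' b.1))) + H₀ * ((-(c • Matrix.diagonal (fun b : (↥(pbox (towerTorus Lc M' (n + 1))) × Fin (d + 1)) => lv v b.1))) * (-(c • Matrix.diagonal (fun b : (↥(pbox (towerTorus Lc M' (n + 1))) × Fin (d + 1)) => lv v' b.1))))))))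
    (𝔔'₁f : V → Matrix κ (↥(pbox (towerTorus Lc M' (n + 1))) × Fin (d + 1)) ℝ) (h𝔔'₁f : ∀ v, 𝔔'₁f v = Xbf v * 𝔔₀ + 𝔔₁f v + 𝔔₀ * (-(c • Matrix.diagonal (fun b : (↥(pbox (towerTorus Lc M' (n + 1))) × Fin (d + 1)) => lv v b.1))))
    (𝔔'₂f : V → V → Matrix κ (↥(pbox (towerTorus Lc M' (n + 1))) × Fin (d + 1)) ℝ)
    (h𝔔'₂f : ∀ v v', 𝔔'₂f v v' = Xbf v * Xbf v' * 𝔔₀ + (Xbf v * 𝔔₁f v' + Xbf v * 𝔔₀ * (-(c • Matrix.diagonal (fun b : (↥(pbox (towerTorus Lc M' (n + 1))) × Fin (d + 1)) => lv v' b.1))))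
      + ((Xbf v * 𝔔₁f v' + Xbf v * 𝔔₀ * (-(c • Matrix.diagonal (fun b : (↥(pbox (towerTorus Lc M' (n + 1))) × Fin (d + 1)) => lv v' b.1)))) + (𝔔₂f v v' + 𝔔₁f v * (-(c • Matrix.diagonal (fun b : (↥(pbox (towerTorus Lc M' (n + 1))) × Fin (d + 1)) => lv v' b.1))) + (𝔔₁f v * (-(c • Matrix.diagonal (fun b : (↥(pbox (towerTorus Lc M' (n + 1))) × Fin (d + 1)) => lv v' b.1))) + 𝔔₀ * ((-(c • Matrix.diagonal (fun b : (↥(pbox (towerTorus Lc M' (n + 1))) × Fin (d + 1)) => lv v b.1))) * (-(c • Matrix.diagonal (fun b : (↥(pbox (towerTorus Lc M' (n + 1))) × Fin (d + 1)) => lv v' b.1))))))))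
    -- #21's generator jets by their closed forms at `h := hv v` (weight `h`), per direction
    (W₁f W₂f : V → Matrix (↥(pbox (towerTorus Lc M' (n + 1))) × Fin (d + 1)) (NParam Lc M' rs (n + 1)) ℝ)
    (hW₁f : ∀ v, W₁f v = Matrix.of fun (b : (↥(pbox (towerTorus Lc M' (n + 1))) × Fin (d + 1))) (e : (NParam Lc M' rs (n + 1))) => -(c * hv v b * evalN Lc M' rs (n + 1) (fun b' : (↥(pbox (towerTorus Lc M' (n + 1))) × Fin (d + 1)) => (b'.1 : Site (d + 1)) + unitVec b'.2) b e))
    (hW₂f : ∀ v, W₂f v = Matrix.of fun (b : (↥(pbox (towerTorus Lc M' (n + 1))) × Fin (d + 1))) (e : (NParam Lc M' rs (n + 1))) => (c * hv v b) ^ 2 * evalN Lc M' rs (n + 1) (fun b' : (↥(pbox (towerTorus Lc M' (n + 1))) × Fin (d + 1)) => (b'.1 : Site (d + 1)) + unitVec b'.2) b e)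
    -- the (COV-m) order-1∕2 images and the (WARD-m) sources, per direction (free)
    (Db₁f Db₂f : V → Matrix (↥(pbox M') × Fin (d + 1)) (Res (toSite (rs 0)) Lc M') ℝ) (Y₁f Y₂f : V → Matrix κ (NParam Lc M' rs (n + 1)) ℝ)
    -- the `G`-side DRESSED WORDS, NAMED (#36b's shapes at `B := [Q₁₁f v; 0]`)
    (Gw₁f : V → Matrix (↥(pbox M') × Fin (d + 1)) (↥(pbox M') × Fin (d + 1)) ℝ)
    (hGw₁f : ∀ v, Gw₁f v = ((L * (H₁f v) - S * (fromRows (Q₁₁f v) (0 : Matrix (NParam Lc (fine Lc M') (fun k => rs (k + 1)) n) (↥(pbox (towerTorus Lc M' (n + 1))) × Fin (d + 1)) ℝ))) * I + L * (fromRows (Q₁₁f v) (0 : Matrix (NParam Lc (fine Lc M') (fun k => rs (k + 1)) n) (↥(pbox (towerTorus Lc M' (n + 1))) × Fin (d + 1)) ℝ))ᵀ * S).toBlocks₁₁)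
    (Gw₂f : V → V → Matrix (↥(pbox M') × Fin (d + 1)) (↥(pbox M') × Fin (d + 1)) ℝ)
    (hGw₂f : ∀ v v', Gw₂f v v' =
      ((((-((L * (H₁f v) - S * (fromRows (Q₁₁f v) (0 : Matrix (NParam Lc (fine Lc M') (fun k => rs (k + 1)) n) (↥(pbox (towerTorus Lc M' (n + 1))) × Fin (d + 1)) ℝ))) * Γ - L * (fromRows (Q₁₁f v) (0 : Matrix (NParam Lc (fine Lc M') (fun k => rs (k + 1)) n) (↥(pbox (towerTorus Lc M' (n + 1))) × Fin (d + 1)) ℝ))ᵀ * L) * (H₁f v') + L * (H₂f v v')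
          - (((L * (H₁f v) - S * (fromRows (Q₁₁f v) (0 : Matrix (NParam Lc (fine Lc M') (fun k => rs (k + 1)) n) (↥(pbox (towerTorus Lc M' (n + 1))) × Fin (d + 1)) ℝ))) * I + L * (fromRows (Q₁₁f v) (0 : Matrix (NParam Lc (fine Lc M') (fun k => rs (k + 1)) n) (↥(pbox (towerTorus Lc M' (n + 1))) × Fin (d + 1)) ℝ))ᵀ * S) * (fromRows (Q₁₁f v') (0 : Matrix (NParam Lc (fine Lc M') (fun k => rs (k + 1)) n) (↥(pbox (towerTorus Lc M' (n + 1))) × Fin (d + 1)) ℝ)) + S * (fromRows (Q₁₂f v v') (0 : Matrix (NParam Lc (fine Lc M') (fun k => rs (k + 1)) n) (↥(pbox (towerTorus Lc M' (n + 1))) × Fin (d + 1)) ℝ)))) * I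
        + (L * (H₁f v) - S * (fromRows (Q₁₁f v) (0 : Matrix (NParam Lc (fine Lc M') (fun k => rs (k + 1)) n) (↥(pbox (towerTorus Lc M' (n + 1))) × Fin (d + 1)) ℝ))) * (-((Γ * (H₁f v') + I * (fromRows (Q₁₁f v') (0 : Matrix (NParam Lc (fine Lc M') (fun k => rs (k + 1)) n) (↥(pbox (towerTorus Lc M' (n + 1))) × Fin (d + 1)) ℝ))) * I + Γ * (fromRows (Q₁₁f v') (0 : Matrix (NParam Lc (fine Lc M') (fun k => rs (k + 1)) n) (↥(pbox (towerTorus Lc M' (n + 1))) × Fin (d + 1)) ℝ))ᵀ * S)))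
      - ((-((L * (H₁f v) - S * (fromRows (Q₁₁f v) (0 : Matrix (NParam Lc (fine Lc M') (fun k => rs (k + 1)) n) (↥(pbox (towerTorus Lc M' (n + 1))) × Fin (d + 1)) ℝ))) * Γ - L * (fromRows (Q₁₁f v) (0 : Matrix (NParam Lc (fine Lc M') (fun k => rs (k + 1)) n) (↥(pbox (towerTorus Lc M' (n + 1))) × Fin (d + 1)) ℝ))ᵀ * L) * (-(fromRows (Q₁₁f v') (0 : Matrix (NParam Lc (fine Lc M') (fun k => rs (k + 1)) n) (↥(pbox (towerTorus Lc M' (n + 1))) × Fin (d + 1)) ℝ))ᵀ) + L * (fromRows (Q₁₂f v v') (0 : Matrix (NParam Lc (fine Lc M') (fun k => rs (k + 1)) n) (↥(pbox (towerTorus Lc M' (n + 1))) × Fin (d + 1)) ℝ))ᵀ) * S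
          + L * (-(fromRows (Q₁₁f v) (0 : Matrix (NParam Lc (fine Lc M') (fun k => rs (k + 1)) n) (↥(pbox (towerTorus Lc M' (n + 1))) × Fin (d + 1)) ℝ))ᵀ) * ((L * (H₁f v') - S * (fromRows (Q₁₁f v') (0 : Matrix (NParam Lc (fine Lc M') (fun k => rs (k + 1)) n) (↥(pbox (towerTorus Lc M' (n + 1))) × Fin (d + 1)) ℝ))) * I + L * (fromRows (Q₁₁f v') (0 : Matrix (NParam Lc (fine Lc M') (fun k => rs (k + 1)) n) (↥(pbox (towerTorus Lc M' (n + 1))) × Fin (d + 1)) ℝ))ᵀ * S)))).toBlocks₁₁)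
    -- #21's ROWS, FOR EVERY DIRECTION: the coarse chart's Faddeev–Popov 2-jet, the form parities, the graded Ward rows, (COV-m) orders 1, 2 on both levels
    (uTop : ∀ v, secondVar (τ₂ * Dbar) (τ₂ * Db₁f v) (τ₂ * Db₂f v) = 0)
    (hH₁t : ∀ v, (H₁f v)ᵀ = -H₁f v) (hH₂t : ∀ v, (H₂f v v)ᵀ = H₂f v v)
    -- (WARD-m) ORDER 0 and the top step's (COV-m) ORDER 0 — direction-free, DISPLAYED for the abstract families (rooted: `torus_a0_tower` ∕ `Qtop_mul_smul_tgrad_res`)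
    (a0 : H₀ * W₀ = 0) (d0 : Q₂₀ * Dbar = 0)
    (a1 : ∀ v, H₁f v * W₀ + H₀ * W₁f v = 𝔔₀ᵀ * Y₁f v)
    (a2 : ∀ v, H₂f v v * W₀ + (2 : ℝ) • (H₁f v * W₁f v) + H₀ * W₂f v = -((2 : ℝ) • ((𝔔₁f v)ᵀ * Y₁f v)) + 𝔔₀ᵀ * Y₂f v)
    (c1 : ∀ v, Q₁₁f v * W₀ + Q₁₀ * W₁f v = fromCols (Db₁f v) (0 : Matrix (↥(pbox M') × Fin (d + 1)) (NParam Lc (fine Lc M') (fun k => rs (k + 1)) n) ℝ))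
    (c2 : ∀ v, Q₁₂f v v * W₀ + (2 : ℝ) • (Q₁₁f v * W₁f v) + Q₁₀ * W₂f v = fromCols (Db₂f v) (0 : Matrix (↥(pbox M') × Fin (d + 1)) (NParam Lc (fine Lc M') (fun k => rs (k + 1)) n) ℝ))
    (d1 : ∀ v, Q₂₁f v * Dbar + Q₂₀ * Db₁f v = 0) (d2 : ∀ v, Q₂₂f v v * Dbar + (2 : ℝ) • (Q₂₁f v * Db₁f v) + Q₂₀ * Db₂f v = 0)
    -- right inverses of the three base systems (leaf-05's `kkt_mul_inv_oneShot` ×2 and #41b `kkt_mul_inv_combAt` after the unit, at the record)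
    {XN : Matrix ((↥(pbox (towerTorus Lc M' (n + 1))) × Fin (d + 1)) ⊕ (κ ⊕ (NParam Lc M' rs (n + 1)))) ((↥(pbox (towerTorus Lc M' (n + 1))) × Fin (d + 1)) ⊕ (κ ⊕ (NParam Lc M' rs (n + 1)))) ℝ} (hXN : kkt H₀ (fromRows 𝔔₀ P) * XN = 1)
    {XF : Matrix ((↥(pbox (towerTorus Lc M' (n + 1))) × Fin (d + 1)) ⊕ ((↥(pbox M') × Fin (d + 1)) ⊕ (NParam Lc (fine Lc M') (fun k => rs (k + 1)) n))) ((↥(pbox (towerTorus Lc M' (n + 1))) × Fin (d + 1)) ⊕ ((↥(pbox M') × Fin (d + 1)) ⊕ (NParam Lc (fine Lc M') (fun k => rs (k + 1)) n))) ℝ} (hXF : kkt H₀ (fromRows Q₁₀ τ₁) * XF = 1)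
    {XG : Matrix ((↥(pbox M') × Fin (d + 1)) ⊕ (κ ⊕ (Res (toSite (rs 0)) Lc M'))) ((↥(pbox M') × Fin (d + 1)) ⊕ (κ ⊕ (Res (toSite (rs 0)) Lc M'))) ℝ} (hXG : kkt S.toBlocks₁₁ (fromRows Q₂₀ τ₂) * XG = 1)
    -- a finite family of directions, a pair
    {σ : Type*} [Fintype σ] [DecidableEq σ] (dv : σ → V) (k l : σ) :
    hessT (XN.submatrix (Sum.map id Sum.inl) (Sum.map id Sum.inl))
        (fromBlocks (H'₁f (dv k)) (-(𝔔'₁f (dv k))ᵀ) (𝔔'₁f (dv k)) 0) (fromBlocks (H'₁f (dv l)) (-(𝔔'₁f (dv l))ᵀ) (𝔔'₁f (dv l)) 0)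
        (kkt ((1 / 2 : ℝ) • (H'₂f (dv k) (dv l) + H'₂f (dv l) (dv k))) ((1 / 2 : ℝ) • (𝔔'₂f (dv k) (dv l) + 𝔔'₂f (dv l) (dv k))))
      = hessT (XF.submatrix (Sum.map id Sum.inl) (Sum.map id Sum.inl))
          (fromBlocks (H₁f (dv k)) (-(Q₁₁f (dv k))ᵀ) (Q₁₁f (dv k)) 0) (fromBlocks (H₁f (dv l)) (-(Q₁₁f (dv l))ᵀ) (Q₁₁f (dv l)) 0)
          (kkt ((1 / 2 : ℝ) • (H₂f (dv k) (dv l) + H₂f (dv l) (dv k))) ((1 / 2 : ℝ) • (Q₁₂f (dv k) (dv l) + Q₁₂f (dv l) (dv k))))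
        + hessT (XG.submatrix (Sum.map id Sum.inl) (Sum.map id Sum.inl))
          (fromBlocks (Gw₁f (dv k)) (-(Q₂₁f (dv k))ᵀ) (Q₂₁f (dv k)) 0) (fromBlocks (Gw₁f (dv l)) (-(Q₂₁f (dv l))ᵀ) (Q₂₁f (dv l)) 0)
          (kkt ((1 / 2 : ℝ) • (Gw₂f (dv k) (dv l) + Gw₂f (dv l) (dv k))) ((1 / 2 : ℝ) • (Q₂₂f (dv k) (dv l) + Q₂₂f (dv l) (dv k)))) := by
  -- the field transport generator `X(v) = −(c • diagonal (λ(v) ∘ pr))` is linear in the direction (#34)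
  have hXl : ∀ (r : ℝ) (x y : V), (-(c • Matrix.diagonal (fun b : (↥(pbox (towerTorus Lc M' (n + 1))) × Fin (d + 1)) => lv (r • x + y) b.1)))
      = r • (-(c • Matrix.diagonal (fun b : (↥(pbox (towerTorus Lc M' (n + 1))) × Fin (d + 1)) => lv x b.1))) + (-(c • Matrix.diagonal (fun b : (↥(pbox (towerTorus Lc M' (n + 1))) × Fin (d + 1)) => lv y b.1))) :=
    fun r x y => lin_negDiagonal_comp c (fun b : (↥(pbox (towerTorus Lc M' (n + 1))) × Fin (d + 1)) => b.1) lv hlv r x y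
  refine hessT_law_of_mixedVar_law _ _ _ _ _ _ _ _ _ _ _ _ _ _ _ _ _ _ ?_ hXN hXF hXG
  exact mixedVar_kernel_law_of_nested_door (kkt H₀ (fromRows 𝔔₀ P)) (kkt H₀ (fromRows Q₁₀ τ₁)) (kkt S.toBlocks₁₁ (fromRows Q₂₀ τ₂)) H₀ Q₁₀ Q₂₀ 𝔔₀ Γ I L S
    (fun v => -(c • Matrix.diagonal (fun b : (↥(pbox (towerTorus Lc M' (n + 1))) × Fin (d + 1)) => lv v b.1))) hXl Xbf hXbf H₁f hH₁l Q₁₁f hQ₁₁l Q₂₁f hQ₂₁l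
    H₂f hH₂l hH₂r Q₁₂f hQ₁₂l hQ₁₂r Q₂₂f hQ₂₂l hQ₂₂r 𝔔₁f h𝔔₁ 𝔔₂f h𝔔₂ H'₁f hH'₁f H'₂f hH'₂f 𝔔'₁f h𝔔'₁f 𝔔'₂f h𝔔'₂f Gw₁f hGw₁f Gw₂f hGw₂f
    (fun v => secondVar_oneShot_nestedStepLaw_torus_composite_graded_oneShot_of_uTop_G M' Lc lev rs n Q K hrs hlev hM'
      (hH₀ := hH₀) (hQ₁₀ := hQ₁₀) (hτ₁ := hτ₁) (hH₀t := hH₀t) (hone := hone) (hId := hId) (hSL := hSL) (hτ₂ := hτ₂) (Q₂₀ := Q₂₀) (htop := htop) (hW₀ := hW₀) (hP := hP)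
      (H₁ := H₁f v) (H₂ := H₂f v v) (Q₁₁ := Q₁₁f v) (Q₁₂ := Q₁₂f v v) (Q₂₁ := Q₂₁f v) (Q₂₂ := Q₂₂f v v) (lam := lv v) (c := c) (h := hv v)
      (hW₁ := hW₁f v) (hW₂ := hW₂f v) (hDbar := hDbar) (c0 := c0) (hTW := hTW) (Db₁ := Db₁f v) (Db₂ := Db₂f v) (Y₁ := Y₁f v) (Y₂ := Y₂f v) (hX := rfl) (Xbar := Xbf v)
      (hW'₁ := rfl) (hW'₂ := rfl) (hC₁ := rfl) (hC₂ := rfl) (h𝔔₀ := h𝔔₀) (h𝔔₁ := h𝔔₁ v) (h𝔔₂ := h𝔔₂ v v)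
      (k1 := (hH'₁f v).symm) (k2 := (hH'₂f v v).symm) (q1 := (h𝔔'₁f v).symm) (q2 := (h𝔔'₂f v v).symm)
      (hΓ := hΓ) (hI := hI) (hL := hL) (hS := hS) (hB := rfl) (uTop := uTop v) (hH₁t := hH₁t v) (hH₂t := hH₂t v)
      (a0 := a0) (a1 := a1 v) (a2 := a2 v) (c1 := c1 v) (c2 := c2 v) (d0 := d0) (d1 := d1 v) (d2 := d2 v))
    dv k l

end TowerG

end Summit.QuantumFields.BalabanUV.Beta.FP.NestedDoorSocketTowerGB

end
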